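import Summits.Parity.GeneralizedHardyLittlewood.Theorems.GreenTaoLevelTwoMNTwoRotationBohrSize

/-!
# Route `GreenTaoLevelTwo`, crux `MNTwo` (stmt-Parity-21276), line `birth`, stub `stub_mnVertical`:
# doubling of rotation Bohr sets in `ℤ` (GT 2008b Lemma 14 (b))

Brick for blocks V2–V6 of the `stub_mnVertical` census (B. Green, T. Tao, *Quadratic uniformity of the
Möbius function*, Ann. Inst. Fourier 58 (2008) = arXiv:math/0606087, §6 Lemma 14 (b): "We have
`|B_g(0,2ρ)| ≪_{G/Γ} |B_g(0,ρ)|` … we cover the ball with centre `0` and radius `2ρ` by `O(1)` balls of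
radius `ρ/4`, and the interval by `O(1)` intervals of length `ρN/4` … pigeonhole").  Same vocabulary as
`…MNTwoRotationBohrSize` (`‖n‖_α = maxᵢ ‖nαᵢ‖_{ℝ/ℤ} + |n|/N`).  Def-free, explicit constant `32 · 38ᵏ`:

* `coe_sub_eq_coe_round_sub` — `((n−n₀)α : ℝ/ℤ) = (r(nα) − r(n₀α) : ℝ/ℤ)`, `r(t) = t − round t`;
* `card_rotationBohr_two_mul_le` — `#B_α(0,2ρ) ≤ 32 · 38ᵏ · #B_α(0,ρ)` for `0 < ρ ≤ 1/4`.

References: [GreenTao2008QuadraticMobius] arXiv:math/0606087 §6, Lemma 14 (b).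
-/

noncomputable section

open Finset Real

namespace Summit.Parity.GeneralizedHardyLittlewood.GreenTaoLevelTwoMNTwoRotationBohrDoubling

open Summit.Parity.GeneralizedHardyLittlewood.GreenTaoLevelTwoMNTwoRotationBohrSize
  (norm_coe_le_abs' abs_sub_lt_of_floor_eq)

/-- On the circle, `(n−n₀)α` equals the difference of the signed representatives
`r(t) = t − round t` of `nα` and `n₀α`. [folklore] -/
theorem coe_sub_eq_coe_round_sub (u v : ℝ) :
    (((u - v : ℝ)) : AddCircle (1 : ℝ)) =
      (((u - round u) - (v - round v) : ℝ) : AddCircle (1 : ℝ)) := by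
  rw [← sub_eq_zero, ← AddCircle.coe_sub, AddCircle.coe_eq_zero_iff]
  refine ⟨round u - round v, ?_⟩
  rw [zsmul_eq_mul, mul_one]
  push_cast
  ring

/-- **Doubling of rotation Bohr sets (GT 2008b Lemma 14 (b)).**  For `N ≥ 1`, `α ∈ ℝᵏ` and
`0 < ρ ≤ 1/4`: `#B_α(0,2ρ) ≤ 32 · 38ᵏ · #B_α(0,ρ)`, where
`B_α(0,r) = {n ∈ ℤ, |n| < N : (∀ i, ‖nαᵢ‖_{ℝ/ℤ} + |n|/N < r) ∧ |n|/N < r}`.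
[cite: GreenTao2008QuadraticMobius, Lemma 14 (b)] -/
theorem card_rotationBohr_two_mul_le (k : ℕ) {N : ℕ} (hN : 1 ≤ N) (α : Fin k → ℝ) {ρ : ℝ}
    (hρ : 0 < ρ) (hρ4 : ρ ≤ 1 / 4) :
    (#((Finset.Ioo (-(N : ℤ)) N).filter fun n : ℤ =>
        (∀ i, ‖(((n : ℝ) * α i : ℝ) : AddCircle (1 : ℝ))‖ + |(n : ℝ)| / N < 2 * ρ) ∧
          |(n : ℝ)| / N < 2 * ρ) : ℝ) ≤
      32 * 38 ^ k * #((Finset.Ioo (-(N : ℤ)) N).filter fun n : ℤ =>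
        (∀ i, ‖(((n : ℝ) * α i : ℝ) : AddCircle (1 : ℝ))‖ + |(n : ℝ)| / N < ρ) ∧ |(n : ℝ)| / N < ρ) := by
  classical
  have hNpos : (0 : ℝ) < N := by exact_mod_cast hN
  set B₂ := (Finset.Ioo (-(N : ℤ)) N).filter fun n : ℤ =>
    (∀ i, ‖(((n : ℝ) * α i : ℝ) : AddCircle (1 : ℝ))‖ + |(n : ℝ)| / N < 2 * ρ) ∧ |(n : ℝ)| / N < 2 * ρ
    with hB₂
  set B := (Finset.Ioo (-(N : ℤ)) N).filter fun n : ℤ =>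
    (∀ i, ‖(((n : ℝ) * α i : ℝ) : AddCircle (1 : ℝ))‖ + |(n : ℝ)| / N < ρ) ∧ |(n : ℝ)| / N < ρ with hB
  have hmem₂ : ∀ {n : ℤ}, n ∈ B₂ → (∀ i, ‖(((n : ℝ) * α i : ℝ) : AddCircle (1 : ℝ))‖ < 2 * ρ) ∧
      |(n : ℝ)| < 2 * ρ * N := by
    intro n hn
    rw [hB₂, mem_filter] at hn
    refine ⟨fun i => ?_, ?_⟩
    · have h1 := hn.2.1 i
      have h2 : 0 ≤ |(n : ℝ)| / N := by positivity
      linarith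
    · have h1 := hn.2.2
      rwa [div_lt_iff₀ hNpos] at h1
  -- `0 ∈ B₂`, so `B₂` is nonempty
  have h0B₂ : (0 : ℤ) ∈ B₂ := by
    rw [hB₂, mem_filter, mem_Ioo]
    refine ⟨⟨by omega, by omega⟩, fun i => ?_, by simp; positivity⟩
    simp; positivity
  -- the cells
  set L : ℕ := ⌈8 / ρ⌉₊ with hL
  have hLpos : (0 : ℝ) < L := by
    rw [hL]; exact_mod_cast Nat.ceil_pos.2 (by positivity)
  have hLge : 8 / ρ ≤ (L : ℝ) := by rw [hL]; exact Nat.le_ceil _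
  have hLle : (L : ℝ) ≤ 9 / ρ := by
    rw [hL]
    have h1 := Nat.ceil_lt_add_one (show (0 : ℝ) ≤ 8 / ρ by positivity)
    have h2 : (1 : ℝ) ≤ 1 / ρ := by rw [le_div_iff₀ hρ]; linarith
    have : (8 : ℝ) / ρ + 1 ≤ 9 / ρ := by
      rw [show (9 : ℝ) / ρ = 8 / ρ + 1 / ρ by ring]; linarith
    linarith
  have hinvL : 1 / (L : ℝ) ≤ ρ / 8 := by
    rw [div_le_iff₀ hLpos]; rw [div_le_iff₀ hρ] at hLge; linarith
  have hρL : 4 * ρ * L ≤ 36 := by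
    calc 4 * ρ * L ≤ 4 * ρ * (9 / ρ) := mul_le_mul_of_nonneg_left hLle (by positivity)
      _ = 36 := by field_simp; ring
  have hhalf : 0 ≤ 1 / 2 - 2 * ρ := by linarith
  set a : ℕ := ⌊(1 / 2 - 2 * ρ) * L⌋₊ with ha
  have ha_le : (a : ℝ) ≤ (1 / 2 - 2 * ρ) * L := Nat.floor_le (mul_nonneg hhalf hLpos.le)
  have ha_lt : (1 / 2 - 2 * ρ) * L < a + 1 := Nat.lt_floor_add_one _
  set W : ℝ := 8 / (ρ * N) with hW
  have hWpos : 0 < W := by rw [hW]; positivity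
  -- the cell map
  set f : ℤ → (Fin k → ℕ) × ℕ := fun n =>
    (fun i => ⌊((n : ℝ) * α i - round ((n : ℝ) * α i) + 1 / 2) * L⌋₊,
      ⌊((n : ℝ) + 2 * ρ * N) * W⌋₊) with hf
  set t : Finset ((Fin k → ℕ) × ℕ) := (Fintype.piFinset fun _ : Fin k => Icc a (a + 37)) ×ˢ range 32
    with ht
  have hrep : ∀ (n : ℤ) (i : Fin k),
      |(n : ℝ) * α i - round ((n : ℝ) * α i)| = ‖(((n : ℝ) * α i : ℝ) : AddCircle (1 : ℝ))‖ := by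
    intro n i
    rw [AddCircle.norm_eq]; simp
  have hmaps : ∀ n ∈ B₂, f n ∈ t := by
    intro n hn
    obtain ⟨htor, hint⟩ := hmem₂ hn
    rw [ht, mem_product, Fintype.mem_piFinset]
    refine ⟨fun i => ?_, ?_⟩
    · have hr := htor i
      rw [← hrep] at hr
      have hrabs := abs_lt.1 hr
      have hx0 : 0 ≤ ((n : ℝ) * α i - round ((n : ℝ) * α i) + 1 / 2) * L :=
        mul_nonneg (by linarith [hrabs.1]) hLpos.le
      rw [mem_Icc]
      constructor
      · refine (Nat.le_floor_iff hx0).2 ?_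
        refine ha_le.trans ?_
        exact mul_le_mul_of_nonneg_right (by linarith [hrabs.1]) hLpos.le
      · have h1 : ((n : ℝ) * α i - round ((n : ℝ) * α i) + 1 / 2) * L < (a : ℝ) + 38 := by
          have h2 : ((n : ℝ) * α i - round ((n : ℝ) * α i) + 1 / 2) * L <
              (1 / 2 + 2 * ρ) * L := mul_lt_mul_of_pos_right (by linarith [hrabs.2]) hLpos
          have h3 : (1 / 2 + 2 * ρ) * L = (1 / 2 - 2 * ρ) * L + 4 * ρ * L := by ring
          linarith
        have h4 : ⌊((n : ℝ) * α i - round ((n : ℝ) * α i) + 1 / 2) * L⌋₊ < a + 38 := by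
          refine (Nat.floor_lt hx0).2 ?_
          exact_mod_cast h1
        change ⌊((n : ℝ) * α i - round ((n : ℝ) * α i) + 1 / 2) * L⌋₊ ≤ a + 37
        omega
    · rw [mem_range]
      have habs := abs_lt.1 hint
      have hu0 : 0 ≤ ((n : ℝ) + 2 * ρ * N) * W := mul_nonneg (by linarith [habs.1]) hWpos.le
      refine (Nat.floor_lt hu0).2 ?_
      calc ((n : ℝ) + 2 * ρ * N) * W < (4 * ρ * N) * W :=
            mul_lt_mul_of_pos_right (by linarith [habs.2]) hWpos
        _ = ((32 : ℕ) : ℝ) := by rw [hW]; field_simp; ring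
  have hcardt : #t ≤ 32 * 38 ^ k := by
    rw [ht, card_product, Fintype.card_piFinset, prod_const, card_univ, Fintype.card_fin, Nat.card_Icc,
      card_range]
    have : a + 37 + 1 - a = 38 := by omega
    rw [this]; linarith [Nat.zero_le (38 ^ k)]
  have htpos : 0 < #t := card_pos.2 ⟨f 0, hmaps 0 h0B₂⟩
  -- pigeonhole
  set m : ℕ := (#B₂ - 1) / #t with hm
  have hmul : #t * m < #B₂ := by
    have h1 : 1 ≤ #B₂ := card_pos.2 ⟨0, h0B₂⟩
    calc #t * ((#B₂ - 1) / #t) ≤ #B₂ - 1 := by rw [mul_comm]; exact Nat.div_mul_le_self _ _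
      _ < #B₂ := by omega
  obtain ⟨y, -, hfib⟩ := Finset.exists_lt_card_fiber_of_mul_lt_card_of_maps_to hmaps hmul
  set S : Finset ℤ := B₂.filter fun n => f n = y with hS
  have hSm : m < #S := hfib
  have hSne : S.Nonempty := card_pos.1 (lt_of_le_of_lt (Nat.zero_le m) hSm)
  obtain ⟨n₀, hn₀⟩ := hSne
  have hmemS : ∀ {n}, n ∈ S → n ∈ B₂ ∧ f n = y := fun hn => by
    rw [hS, mem_filter] at hn; exact hn
  -- `S - n₀ ⊆ B`
  have hsub : ∀ n ∈ S, n - n₀ ∈ B := by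
    intro n hn
    obtain ⟨hnB, hfn⟩ := hmemS hn
    obtain ⟨hn₀B, hfn₀⟩ := hmemS hn₀
    obtain ⟨htorn, hintn⟩ := hmem₂ hnB
    obtain ⟨htorn₀, hintn₀⟩ := hmem₂ hn₀B
    have hff : f n = f n₀ := hfn.trans hfn₀.symm
    rw [hf] at hff
    simp only [Prod.mk.injEq] at hff
    obtain ⟨hcells, hint⟩ := hff
    -- interval part
    have habs := abs_lt.1 hintn
    have habs₀ := abs_lt.1 hintn₀
    have hclose := abs_sub_lt_of_floor_eq hWpos (by linarith [habs.1]) (by linarith [habs₀.1]) hint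
    have hdiff : |((n : ℝ) - n₀)| < ρ * N / 8 := by
      have e : (n : ℝ) + 2 * ρ * N - ((n₀ : ℝ) + 2 * ρ * N) = (n : ℝ) - n₀ := by ring
      rw [e] at hclose
      have e2 : 1 / W = ρ * N / 8 := by rw [hW]; field_simp
      rwa [e2] at hclose
    -- torus part
    have htor : ∀ i, ‖((((n : ℝ) - n₀) * α i : ℝ) : AddCircle (1 : ℝ))‖ < ρ / 8 := by
      intro i
      have hc := congrFun hcells i
      have hr := htorn i
      have hr₀ := htorn₀ i
      rw [← hrep] at hr hr₀
      have hcl := abs_sub_lt_of_floor_eq hLpos (by linarith [(abs_lt.1 hr).1])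
        (by linarith [(abs_lt.1 hr₀).1]) hc
      have e : ((((n : ℝ) - n₀) * α i : ℝ) : AddCircle (1 : ℝ)) =
          ((((n : ℝ) * α i - round ((n : ℝ) * α i)) - ((n₀ : ℝ) * α i - round ((n₀ : ℝ) * α i)) : ℝ) :
            AddCircle (1 : ℝ)) := by
        rw [sub_mul]; exact coe_sub_eq_coe_round_sub _ _
      rw [e]
      calc ‖((((n : ℝ) * α i - round ((n : ℝ) * α i)) - ((n₀ : ℝ) * α i - round ((n₀ : ℝ) * α i)) : ℝ) :
              AddCircle (1 : ℝ))‖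
          ≤ |((n : ℝ) * α i - round ((n : ℝ) * α i)) - ((n₀ : ℝ) * α i - round ((n₀ : ℝ) * α i))| :=
            norm_coe_le_abs' _
        _ = |((n : ℝ) * α i - round ((n : ℝ) * α i) + 1 / 2) -
              ((n₀ : ℝ) * α i - round ((n₀ : ℝ) * α i) + 1 / 2)| := by ring_nf
        _ < 1 / L := hcl
        _ ≤ ρ / 8 := hinvL
    have hρN : ρ * N / 8 < N := by nlinarith
    have hnI : (-(N : ℤ)) < n - n₀ ∧ n - n₀ < N := by
      have h1 := abs_lt.1 hdiff
      constructor
      · have : (-(N : ℝ)) < (n : ℝ) - n₀ := by linarith [h1.1]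
        exact_mod_cast this
      · have : (n : ℝ) - n₀ < N := by linarith [h1.2]
        exact_mod_cast this
    rw [hB, mem_filter, mem_Ioo]
    have hratio : |((n : ℝ) - n₀)| / N < ρ / 8 := by
      rw [div_lt_iff₀ hNpos]; linarith
    refine ⟨hnI, fun i => ?_, ?_⟩
    · have := htor i
      push_cast
      linarith
    · push_cast
      linarith
  -- count
  have hinj : Set.InjOn (fun n : ℤ => n - n₀) S := fun a _ b _ h => by simpa using h
  have hcardS : #S ≤ #B := by
    rw [← card_image_of_injOn hinj]
    exact card_le_card fun z hz => by
      obtain ⟨n, hn, rfl⟩ := mem_image.1 hz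
      exact hsub n hn
  -- `#B₂ ≤ #t (m + 1) ≤ #t #S ≤ 32·38ᵏ #B`
  have h1 : #B₂ - 1 < m * #t + #t := by rw [hm]; exact Nat.lt_div_mul_add htpos
  have h2 : #B₂ ≤ #t * #S := by
    have : #t * (m + 1) ≤ #t * #S := Nat.mul_le_mul_left _ hSm
    have h3 : #B₂ ≤ #t * (m + 1) := by
      have := card_pos.2 ⟨(0 : ℤ), h0B₂⟩
      rw [Nat.mul_add, Nat.mul_one, Nat.mul_comm]; omega
    exact h3.trans this
  have h3 : #B₂ ≤ 32 * 38 ^ k * #B :=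
    h2.trans ((Nat.mul_le_mul hcardt hcardS))
  exact_mod_cast h3

end Summit.Parity.GeneralizedHardyLittlewood.GreenTaoLevelTwoMNTwoRotationBohrDoubling
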